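import Summits.QuantumFields.YangMills.Theorems.LuscherReductionOneSiteLevelsGnDiag

/-!
# The quasimode Rayleigh bound for a gnomonic pull-back trial state
# (support module for the registered stub `stub_absLower` of crux `OneSiteLevels`, route `LuscherReduction`,
# item stmt-QuantumFields-20007; fleet seat prover ym-luscher-20007-p2)

Combination of `…GnForms` (sum over hemisphere patterns), `…GnDiag` (Gaussian main part − curvature error of the diagonal
term), `…GaussForm` (flat Gaussian form bound) and `…GnPotDerivH` (gradient of the chart factor) into ONE inequality: for a
colour-invariant `C²_c` trial function `G` on `ℝ⁹` supported in `‖y‖ ≤ r`, at chart scale `μ` with `Bμ³ = 1/4`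
(i.e. `μ = λ_b/2`) and window `μ²r² ≤ 1/16`,

`⟨Ψ_G, K_B Ψ_G⟩ ≥ 8 e^{6B} Z c² · (‖G‖² − 2μ·𝔮(G) − ERR(G)) − 7 e^{9B/4} c ‖G‖²`     (`qform_gnTrial_ge`)

with `Ψ_G = G ∘ gnCoord μ`, `Z = √(π/(Bμ²))⁹`, `c = μ⁹(2π²)⁻³`, `𝔮 = energyForm`, and
`ERR(G) = 12μ²∫‖y‖²G² + 2μ²∫‖∇G‖² + 9(μ+½)∫G²·gnLip² + μ²κ(3·2^{9/2}∫‖y‖²G² + 2·2⁹·(4/(e·Bμ²))∫G²)`, `κ = 8/(3e)` —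
every term `O(μ²)` against the decay of `G`.  Here `2μ·𝔮(G)` is EXACTLY `λ_b` times the energy: the Strang form of the kernel.

## WHAT THIS IS NOT
Bookkeeping of the previous modules; NOT the stub, NOT THE CLAY GAP.  Sorry-free, no named fact.
-/

set_option autoImplicit false

noncomputable section

open MeasureTheory Filter Topology Real
open scoped Matrix ENNReal
open Literature.MathematicalPhysics.QuantumFieldTheory
open Literature.MathematicalPhysics.QuantumLattice
open Literature.Analysis.OperatorTheory.YMMatrixModel

namespace Summit.QuantumFields.YangMills.Theorems.FemtoTransferGap

section Gauss

variable {ι : Type*} [Fintype ι]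

/-- `∫ e^{−(b‖s‖²)/2} ds = √2^n √(π/b)^n`. [folklore] -/
theorem integral_exp_neg_half (b : ℝ) (hb : 0 < b) :
    ∫ s : EuclideanSpace ℝ ι, Real.exp (-(b * ‖s‖ ^ 2) / 2) =
      Real.sqrt 2 ^ Fintype.card ι * Real.sqrt (π / b) ^ Fintype.card ι := by
  have e : ∀ s : EuclideanSpace ℝ ι, Real.exp (-(b * ‖s‖ ^ 2) / 2) = Real.exp (-(b / 2) * ‖s‖ ^ 2) := fun s => by
    congr 1; ring
  simp_rw [e]
  rw [GaussForm.integral_exp_neg_mul_sq_norm (by positivity : 0 < b / 2), ← mul_pow]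
  congr 1
  rw [← Real.sqrt_mul (by norm_num : (0:ℝ) ≤ 2)]
  congr 1
  field_simp

/-- `∫ ‖s‖² e^{−(b‖s‖²)/2} ds ≤ (4/(e b)) · 2^n √(π/b)^n`. [folklore] -/
theorem integral_normSq_exp_neg_half_le (b : ℝ) (hb : 0 < b) :
    ∫ s : EuclideanSpace ℝ ι, ‖s‖ ^ 2 * Real.exp (-(b * ‖s‖ ^ 2) / 2) ≤
      4 / (Real.exp 1 * b) * ((2 : ℝ) ^ Fintype.card ι * Real.sqrt (π / b) ^ Fintype.card ι) := by
  have hb4 : 0 < b / 4 := by positivity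
  have hpt : ∀ s : EuclideanSpace ℝ ι, ‖s‖ ^ 2 * Real.exp (-(b * ‖s‖ ^ 2) / 2) ≤
      4 / (Real.exp 1 * b) * Real.exp (-(b / 4) * ‖s‖ ^ 2) := by
    intro s
    have h := GaussForm.mul_exp_neg_le (a := b / 4) (t := ‖s‖ ^ 2) hb4
    have e : Real.exp (-(b * ‖s‖ ^ 2) / 2) = Real.exp (-(b / 4) * ‖s‖ ^ 2) * Real.exp (-(b / 4) * ‖s‖ ^ 2) := by
      rw [← Real.exp_add]; ring_nf
    rw [e, ← mul_assoc]
    refine mul_le_mul_of_nonneg_right (h.trans (le_of_eq ?_)) (Real.exp_pos _).le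
    field_simp
  have hint : Integrable fun s : EuclideanSpace ℝ ι => 4 / (Real.exp 1 * b) * Real.exp (-(b / 4) * ‖s‖ ^ 2) :=
    (GaussForm.integrable_gauss hb4).const_mul _
  calc ∫ s : EuclideanSpace ℝ ι, ‖s‖ ^ 2 * Real.exp (-(b * ‖s‖ ^ 2) / 2)
      ≤ ∫ s : EuclideanSpace ℝ ι, 4 / (Real.exp 1 * b) * Real.exp (-(b / 4) * ‖s‖ ^ 2) :=
        integral_mono_of_nonneg (ae_of_all _ fun s => by positivity) hint (ae_of_all _ hpt)
    _ = 4 / (Real.exp 1 * b) * ((2 : ℝ) ^ Fintype.card ι * Real.sqrt (π / b) ^ Fintype.card ι) := by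
        rw [integral_const_mul, GaussForm.integral_exp_neg_mul_sq_norm hb4, ← mul_pow]
        congr 2
        rw [show π / (b / 4) = 2 ^ 2 * (π / b) by field_simp; ring, Real.sqrt_mul (by norm_num), Real.sqrt_sq (by norm_num)]

end Gauss

section Trial

variable {B μ : ℝ} {G : ZM → ℝ}

/-- `gnLip` is continuous. [folklore] -/
theorem continuous_gnLip (B μ : ℝ) : Continuous (gnLip B μ) := by unfold gnLip; fun_prop

/-- **The quasimode Rayleigh bound for the pull-back of a colour-invariant `C²_c` trial function.** [folklore] -/
theorem qform_gnTrial_ge (hB : 0 < B) (hμ : 0 < μ) (hBμ : B * μ ^ 3 = 1 / 4) (hG : IsTestFn G) (hinv : IsGaugeInv G)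
    {r : ℝ} (hsupp : ∀ y, G y ≠ 0 → ‖y‖ ≤ r) (hr : μ ^ 2 * r ^ 2 ≤ 1 / 16) :
    8 * Real.exp (6 * B) * Real.sqrt (π / (B * μ ^ 2)) ^ 9 * (μ ^ 9 * ((2 * π ^ 2)⁻¹) ^ 3) ^ 2 *
        ((∫ y, G y ^ 2) - 2 * μ * energyForm G -
          (12 * μ ^ 2 * (∫ y, ‖y‖ ^ 2 * G y ^ 2) + 2 * μ ^ 2 * (∫ y, ‖gradient G y‖ ^ 2)
            + 9 * (μ + 1 / 2) * (∫ y, G y ^ 2 * gnLip B μ y ^ 2)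
            + μ ^ 2 * (8 / (3 * Real.exp 1)) * (3 * Real.sqrt 2 ^ 9 * (∫ y, ‖y‖ ^ 2 * G y ^ 2)
              + 2 * (4 / (Real.exp 1 * (B * μ ^ 2)) * (2 : ℝ) ^ 9) * ∫ y, G y ^ 2)))
      - 7 * Real.exp (9 / 4 * B) * (μ ^ 9 * ((2 * π ^ 2)⁻¹) ^ 3) * ∫ y, G y ^ 2 ≤
      qform su2Rep B (fun U : Cfg => G (gnCoord μ U)) (fun U => G (gnCoord μ U)) := by
  -- notation
  set c : ℝ := μ ^ 9 * ((2 * π ^ 2)⁻¹) ^ 3 with hc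
  set B' : ℝ := B * μ ^ 2 with hB'
  set Z : ℝ := Real.sqrt (π / B') ^ 9 with hZ
  have hB'0 : 0 < B' := by positivity
  have hc0 : 0 < c := by positivity
  have hZ0 : 0 < Z := by positivity
  -- data on `G`
  have hGc : Continuous G := hG.continuous
  have hGm : Measurable G := hGc.measurable
  have hGs : HasCompactSupport G := hG.2
  have hG1 : ContDiff ℝ 1 G := hG.1.of_le (by norm_num)
  obtain ⟨CG, _, hCG⟩ := GaussForm.exists_bound_of_hasCompactSupport hGc hGs
  have hb : ∃ C : ℝ, ∀ x, |G x| ≤ C := ⟨CG, hCG⟩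
  have hG2s : HasCompactSupport fun y => G y ^ 2 := GaussForm.hasCompactSupport_sq hGs
  have hN : Integrable fun y => G y ^ 2 := hG.integrable_sq
  have hM2 : Integrable fun y => ‖y‖ ^ 2 * G y ^ 2 := ((continuous_norm.pow 2).mul (hGc.pow 2)).integrable_of_hasCompactSupport hG2s.mul_left
  have hD : Integrable fun y => ‖gradient G y‖ ^ 2 := by
    simp_rw [GaussForm.norm_gradient_eq]
    exact (((hG1.continuous_fderiv one_ne_zero).norm).pow 2).integrable_of_hasCompactSupport
      (GaussForm.hasCompactSupport_sq (hGs.fderiv (𝕜 := ℝ)).norm)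
  have hL : Integrable fun y => G y ^ 2 * gnLip B μ y ^ 2 :=
    ((hGc.pow 2).mul ((continuous_gnLip B μ).pow 2)).integrable_of_hasCompactSupport hG2s.mul_right
  have hV : Integrable fun y => luscherPotential y * G y ^ 2 := hG.integrable_mul_sq continuous_luscherPotential
  -- (1) the sum over patterns
  have h1 := qform_gnPullback_ge hμ hB.le hGm hb hinv hN hsupp hr (fun _ => false)
  -- (2) the diagonal term
  have h2 := gnPairTerm_diag_ge hB hμ hG1 hGs hsupp hr (fun _ => false)
  -- (3) `∫Φ² ≥ c²(N − 12μ²M₂ − 8Bμ⁴ V_G)` and `∫Φ² ≤ c² N`, `∫‖y‖²Φ² ≤ c² M₂`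
  set Φ := gnPhi B μ G with hΦ
  have hΦc : Continuous Φ := (contDiff_gnPhi B μ hG1).continuous
  have hΦs : HasCompactSupport Φ := hasCompactSupport_gnPhi B μ hGs
  have hΦ2 : Integrable fun y => Φ y ^ 2 := (hΦc.pow 2).integrable_of_hasCompactSupport (GaussForm.hasCompactSupport_sq hΦs)
  have hyΦ2 : Integrable fun y => ‖y‖ ^ 2 * Φ y ^ 2 :=
    ((continuous_norm.pow 2).mul (hΦc.pow 2)).integrable_of_hasCompactSupport (GaussForm.hasCompactSupport_sq hΦs).mul_left
  have h3a : c ^ 2 * ((∫ y, G y ^ 2) - 12 * μ ^ 2 * (∫ y, ‖y‖ ^ 2 * G y ^ 2) - 8 * B * μ ^ 4 * ∫ y, luscherPotential y * G y ^ 2)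
      ≤ ∫ y, Φ y ^ 2 := by
    have hi : Integrable fun y => c ^ 2 * (G y ^ 2 * (1 - 12 * (μ ^ 2 * ‖y‖ ^ 2) - 8 * B * μ ^ 4 * luscherPotential y)) := by
      have : (fun y => c ^ 2 * (G y ^ 2 * (1 - 12 * (μ ^ 2 * ‖y‖ ^ 2) - 8 * B * μ ^ 4 * luscherPotential y))) =
          fun y => c ^ 2 * G y ^ 2 - (12 * c ^ 2 * μ ^ 2) * (‖y‖ ^ 2 * G y ^ 2) - (8 * c ^ 2 * B * μ ^ 4) * (luscherPotential y * G y ^ 2) := by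
        funext y; ring
      rw [this]
      exact ((hN.const_mul _).sub (hM2.const_mul _)).sub (hV.const_mul _)
    have hmono := integral_mono hi hΦ2 fun y => gnPhi_sq_ge hB.le μ G y
    have e : ∫ y, c ^ 2 * (G y ^ 2 * (1 - 12 * (μ ^ 2 * ‖y‖ ^ 2) - 8 * B * μ ^ 4 * luscherPotential y)) =
        c ^ 2 * ((∫ y, G y ^ 2) - 12 * μ ^ 2 * (∫ y, ‖y‖ ^ 2 * G y ^ 2) - 8 * B * μ ^ 4 * ∫ y, luscherPotential y * G y ^ 2) := by
      have : (fun y => c ^ 2 * (G y ^ 2 * (1 - 12 * (μ ^ 2 * ‖y‖ ^ 2) - 8 * B * μ ^ 4 * luscherPotential y))) =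
          fun y => c ^ 2 * G y ^ 2 - (12 * c ^ 2 * μ ^ 2) * (‖y‖ ^ 2 * G y ^ 2) - (8 * c ^ 2 * B * μ ^ 4) * (luscherPotential y * G y ^ 2) := by
        funext y; ring
      have i1 : Integrable (fun y => c ^ 2 * G y ^ 2) := hN.const_mul _
      have i2 : Integrable (fun y => (12 * c ^ 2 * μ ^ 2) * (‖y‖ ^ 2 * G y ^ 2)) := hM2.const_mul _
      have i3 : Integrable (fun y => (8 * c ^ 2 * B * μ ^ 4) * (luscherPotential y * G y ^ 2)) := hV.const_mul _
      have i12 : Integrable (fun y => c ^ 2 * G y ^ 2 - (12 * c ^ 2 * μ ^ 2) * (‖y‖ ^ 2 * G y ^ 2)) := i1.sub i2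
      rw [this, integral_sub i12 i3, integral_sub i1 i2, integral_const_mul, integral_const_mul, integral_const_mul]
      ring
    linarith
  have h3b : ∫ y, Φ y ^ 2 ≤ c ^ 2 * ∫ y, G y ^ 2 := by
    rw [← integral_const_mul]
    exact integral_mono hΦ2 (hN.const_mul _) fun y => gnPhi_sq_le hB.le μ G y
  have h3c : ∫ y, ‖y‖ ^ 2 * Φ y ^ 2 ≤ c ^ 2 * ∫ y, ‖y‖ ^ 2 * G y ^ 2 := by
    rw [← integral_const_mul]
    refine integral_mono hyΦ2 (hM2.const_mul _) fun y => ?_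
    have := gnPhi_sq_le hB.le μ G y
    have h0 : 0 ≤ ‖y‖ ^ 2 := sq_nonneg _
    nlinarith
  -- (4) the gradient of `Φ`
  have hgradΦ : Integrable fun y => ‖gradient Φ y‖ ^ 2 := by
    have hΦ1 := contDiff_gnPhi B μ hG1
    simp_rw [GaussForm.norm_gradient_eq]
    exact (((hΦ1.continuous_fderiv one_ne_zero).norm).pow 2).integrable_of_hasCompactSupport
      (GaussForm.hasCompactSupport_sq (hΦs.fderiv (𝕜 := ℝ)).norm)
  have h4 : ∫ y, ‖gradient Φ y‖ ^ 2 ≤ c ^ 2 * ((1 + 2 * μ) * (∫ y, ‖gradient G y‖ ^ 2) + (1 + 1 / (2 * μ)) * (9 * ∫ y, G y ^ 2 * gnLip B μ y ^ 2)) := by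
    have hlam : 0 < 2 * μ := by positivity
    have hpt := fun y => norm_gradient_sq_mul_gnH_le (hG.differentiable) hB.le μ c hlam y
    have hi : Integrable fun y => c ^ 2 * ((1 + 2 * μ) * ‖gradient G y‖ ^ 2 + (1 + 1 / (2 * μ)) * (G y ^ 2 * (9 * gnLip B μ y ^ 2))) := by
      have : (fun y => c ^ 2 * ((1 + 2 * μ) * ‖gradient G y‖ ^ 2 + (1 + 1 / (2 * μ)) * (G y ^ 2 * (9 * gnLip B μ y ^ 2)))) =
          fun y => (c ^ 2 * (1 + 2 * μ)) * ‖gradient G y‖ ^ 2 + (c ^ 2 * (1 + 1 / (2 * μ)) * 9) * (G y ^ 2 * gnLip B μ y ^ 2) := by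
        funext y; ring
      rw [this]; exact (hD.const_mul _).add (hL.const_mul _)
    have hmono := integral_mono hgradΦ hi hpt
    have e : ∫ y, c ^ 2 * ((1 + 2 * μ) * ‖gradient G y‖ ^ 2 + (1 + 1 / (2 * μ)) * (G y ^ 2 * (9 * gnLip B μ y ^ 2))) =
        c ^ 2 * ((1 + 2 * μ) * (∫ y, ‖gradient G y‖ ^ 2) + (1 + 1 / (2 * μ)) * (9 * ∫ y, G y ^ 2 * gnLip B μ y ^ 2)) := by
      have : (fun y => c ^ 2 * ((1 + 2 * μ) * ‖gradient G y‖ ^ 2 + (1 + 1 / (2 * μ)) * (G y ^ 2 * (9 * gnLip B μ y ^ 2)))) =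
          fun y => (c ^ 2 * (1 + 2 * μ)) * ‖gradient G y‖ ^ 2 + (c ^ 2 * (1 + 1 / (2 * μ)) * 9) * (G y ^ 2 * gnLip B μ y ^ 2) := by
        funext y; ring
      rw [this, integral_add (hD.const_mul _) (hL.const_mul _), integral_const_mul, integral_const_mul]; ring
    exact hmono.trans (le_of_eq e)
  -- (5) the energy split and the Gaussian moments
  have hE : energyForm G = (1 / 2 : ℝ) * (∫ y, ‖gradient G y‖ ^ 2) + ∫ y, luscherPotential y * G y ^ 2 := by
    rw [energyForm, integral_add (hD.const_mul _) hV, integral_const_mul]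
  have hcard9 : Fintype.card (Fin 3 × Fin 3) = 9 := by simp
  have hI0 : ∫ s : ZM, diagKer0 B μ s = Real.sqrt 2 ^ 9 * Z := by
    simp only [diagKer0]
    rw [integral_exp_neg_half (ι := Fin 3 × Fin 3) (B * μ ^ 2) hB'0, hcard9]
  have hI2 : ∫ s : ZM, diagKer2 B μ s ≤ 4 / (Real.exp 1 * B') * ((2 : ℝ) ^ 9 * Z) := by
    simp only [diagKer2]
    have := integral_normSq_exp_neg_half_le (ι := Fin 3 × Fin 3) (B * μ ^ 2) hB'0
    rw [hcard9] at this
    exact this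
  -- (6) the scaling identities `1/(4B') = μ`, `8Bμ⁴ = 2μ`
  have hs1 : 1 / (4 * (B * μ ^ 2)) = μ := by
    have : B * μ ^ 2 = 1 / (4 * μ) := by
      rw [eq_div_iff (by positivity)]; linear_combination 4 * hBμ
    rw [this]; field_simp
  have hs2 : 8 * B * μ ^ 4 = 2 * μ := by linear_combination 8 * μ * hBμ
  -- abbreviations
  set n := ∫ y, G y ^ 2 with hn
  set m := ∫ y, ‖y‖ ^ 2 * G y ^ 2 with hm
  set d := ∫ y, ‖gradient G y‖ ^ 2 with hd
  set l := ∫ y, G y ^ 2 * gnLip B μ y ^ 2 with hl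
  set v := ∫ y, luscherPotential y * G y ^ 2 with hv
  set p := ∫ y, Φ y ^ 2 with hp
  set q := ∫ y, ‖gradient Φ y‖ ^ 2 with hq
  set w := ∫ y, ‖y‖ ^ 2 * Φ y ^ 2 with hw
  set I₀ := ∫ s : ZM, diagKer0 B μ s with hI₀
  set I₂ := ∫ s : ZM, diagKer2 B μ s with hI₂
  set κ : ℝ := 8 / (3 * Real.exp 1) with hκ
  have hκ0 : 0 ≤ κ := by positivity
  have hn0 : 0 ≤ n := integral_nonneg fun y => sq_nonneg _
  have hp0 : 0 ≤ p := integral_nonneg fun y => sq_nonneg _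
  have hl0 : 0 ≤ l := integral_nonneg fun y => by positivity
  have hm0 : 0 ≤ m := integral_nonneg fun y => by positivity
  -- main part
  have key1 : c ^ 2 * (n - 2 * μ * energyForm G - 12 * μ ^ 2 * m - 2 * μ ^ 2 * d - 9 * (μ + 1 / 2) * l) ≤ p - μ * q := by
    rw [hE]
    have hq' := mul_le_mul_of_nonneg_left h4 hμ.le
    have e : μ * (c ^ 2 * ((1 + 2 * μ) * d + (1 + 1 / (2 * μ)) * (9 * l))) =
        c ^ 2 * (μ * (1 + 2 * μ) * d + (μ + 1 / 2) * 9 * l) := by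
      field_simp
    rw [hs2] at h3a
    rw [e] at hq'
    linarith only [h3a, hq']
  -- error part
  have key2 : μ ^ 2 * κ * (3 * I₀ * w + 2 * I₂ * p) ≤
      Z * c ^ 2 * (μ ^ 2 * κ * (3 * Real.sqrt 2 ^ 9 * m + 2 * (4 / (Real.exp 1 * B') * (2 : ℝ) ^ 9) * n)) := by
    have e1 : I₀ * w ≤ Real.sqrt 2 ^ 9 * Z * (c ^ 2 * m) := by
      rw [hI0]; exact mul_le_mul_of_nonneg_left h3c (by positivity)
    have e2 : I₂ * p ≤ 4 / (Real.exp 1 * B') * ((2 : ℝ) ^ 9 * Z) * (c ^ 2 * n) :=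
      mul_le_mul hI2 h3b hp0 (by positivity)
    have h3 : 3 * I₀ * w + 2 * I₂ * p ≤ Z * c ^ 2 * (3 * Real.sqrt 2 ^ 9 * m + 2 * (4 / (Real.exp 1 * B') * (2 : ℝ) ^ 9) * n) := by
      linear_combination 3 * e1 + 2 * e2
    have := mul_le_mul_of_nonneg_left h3 (by positivity : 0 ≤ μ ^ 2 * κ)
    exact this.trans_eq (by ring)
  -- the diagonal term
  rw [hcard9, hs1] at h2
  have hT : Real.exp (6 * B) * (Z * c ^ 2 * (n - 2 * μ * energyForm G - (12 * μ ^ 2 * m + 2 * μ ^ 2 * d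
        + 9 * (μ + 1 / 2) * l + μ ^ 2 * κ * (3 * Real.sqrt 2 ^ 9 * m + 2 * (4 / (Real.exp 1 * B') * (2 : ℝ) ^ 9) * n)))) ≤
      gnPairTerm B μ G (fun _ => false, fun _ => false) := by
    refine le_trans (mul_le_mul_of_nonneg_left ?_ (Real.exp_pos _).le) h2
    have hZ1 := mul_le_mul_of_nonneg_left key1 hZ0.le
    linarith only [hZ1, key2]
  -- the density bound `∫ρG² ≤ c n`
  have hρG : ∫ y, gnDensityReal μ y * G y ^ 2 ≤ c * n := by
    rw [hn, ← integral_const_mul]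
    exact integral_mono_of_nonneg (ae_of_all _ fun y => mul_nonneg (gnDensityReal_pos hμ y).le (sq_nonneg _)) (hN.const_mul _)
      (ae_of_all _ fun y => mul_le_mul_of_nonneg_right (gnDensityReal_le hμ y) (sq_nonneg _))
  have h7 := mul_le_mul_of_nonneg_left hρG (by positivity : 0 ≤ 7 * Real.exp (9 / 4 * B))
  linarith only [h1, hT, h7]

end Trial

end Summit.QuantumFields.YangMills.Theorems.FemtoTransferGap

end
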